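import Summits.HodgeConjecture.HodgeConjecture.Theorems.Ring2ClassTargetsRowsSixSevenWeilPullbacks
import Summits.HodgeConjecture.HodgeConjecture.Theorems.Ring2ClassTargetsRowsSixSevenAtlas
import Summits.HodgeConjecture.HodgeConjecture.Theorems.Ring2TransportWeilClasses
import Summits.HodgeConjecture.HodgeConjecture.Theorems.Ring2TransportDivisorGeneratedAnchors
import HarnessLib

/-!
# Ring 2 — class targets: WEIL-PULL-BACK-GENERATED members and the K3-partner row, priced in the kernel (typer 1)

research route conditional on HC_CM; not a corollary; Q11.4-sentence-2 already refuted in dim ≥ 3.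

Cell `pub-hodge-ring2`, seat typer1 = cell LEAD (gen 8). `HC_CM` := the binder
`Theses.RankFourFaces.CMAbelianHodge` (stmt-HodgeConjecture-3052) BY NAME; nothing here proves it, `HC_AV`
(stmt-1333) or `CMToAbelian` (stmt-16267); nothing here is a new case of the Hodge conjecture. No `sorry`, no
named fact. New DEFINITIONS (typed HYPOTHESIS SHAPES on a member, nothing asserted): `IsCodimTwoGeneratedBy`,
`IsCodimThreeProductGenerated`, `IsWeilPullbackGenerated` (§G0).

PURPOSE — the PER-MEMBER form of the rows-`≤ 7` reduction, for the cells the census X2 misses. The induction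
`mem_algebraicClasses_of_dim_le_seven_of_censusOff_weilPullbacks` (p193119) demands the census X2′ / X1 on ALL
six- and sevenfolds off a class and pays the lower-dimensional pull-backs with the floor `HCUpToDim 5` and the
Weil-sixfold summand with `W₆`. A single member `A` (`dim A ≤ 7`) whose Hodge ring has the K3-PARTNER SHAPE —
codimension `2` generated by `D²` and André's codimension-2 Weil pull-backs `codimTwoWeilPullbacks A` (X2′'s third
summand: pull-backs of rational `(2,2)` Weil classes of Weil-type FOURFOLDS and of CM-FIELD Weil-type abelian
varieties of dimension `2e ≥ 8`), codimension `3` generated by `D³` and `B²·B¹` — needs NEITHER: §G1 proves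
`HC(A)` from Lefschetz `(1,1)`, products with divisors, hard Lefschetz and ONE priced input, the algebraicity of
the seed classes; §G2 prices the seeds exactly as `Ring2ClassTargetsRowsSixSevenWeilPullbacks` does (floor fact for
the fourfold sources; the codimension-2 CM-field price `CodimTwoWeilClassesCMFieldOff 𝒞` = the `2m = 4` slice of
rung R3 off a class `𝒞`, plus HC on `𝒞`); §G3 assembles the per-member and per-class theorems in three readings —
(R) floor fact ∧ R3: `HC_CM` ABSENT; (C) HC on `𝒞` ∧ floor ∧ price off `𝒞` (with `𝒞 = CM`: `HC_CM` + price off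
the CM locus); (T) `HC_CM` + the four transport leaves of `Ring2TransportWeilClasses` (or the floor fact + the two
CM-FIELD leaves: `HC_CM` load-bearing ONCE); §G4 instantiates them at atlas-2's typed K3-PARTNER CELL
`Ring2.Atlas.HodgeQuarticTypeIVFourfoldTimesCMSurface` (p191466; `HC(Y × Z)`, `Y` a simple quartic-field type-IV
fourfold, `Z` a CM surface) BY NAME, with the generation shape entered as a HYPOTHESIS ON THE MEMBERS; §G5 audit.

PLACEMENT (RING2-MAP §LEAD gen 7 L7.3, hodge-weil CARVER v28 C184 (h), deform D.49): by the cell's computation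
K3-WP (evidence `K3-WEIL-PULLBACK.md` on stmt-HodgeConjecture-18721; two independent implementations + referee
reproduction + hand proof; NOT in print, NOT a Lean theorem) and the atlas census (`B = D + D·K`, `b_p − d_p = 4`
for `p = 2, 3, 4`; engines B / A1 / A3, certified) the K3-partner sixfolds HAVE the shape `IsWeilPullbackGenerated`
— with seeds in the CM-FIELD summand only (source: the `E`-Weil eightfold `Y × Z × Z`, `m = 2`). That shape is a
HYPOTHESIS below (ABSOLUTE RULE: no internally computed statement enters as a fact). READ THROUGH §G4 (R): the cell
is a CONSEQUENCE of the floor fact ∧ R3 — in fact of R3's codimension-2 slice at the sources — i.e. "above Markman's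
floor, under rung R3, not a rung" (L7.3 (a)(b)); the floor fact enters only through the fourfold summand, which the
K3-partner seeds do not use (the sharper `S₂`-only pricing is `Ring2ClassTargetsWeilPullbacksSplit`, p194036).
Atlas-2's `HC_CM`-free claim for `E = ℚ(ζ₅)` (`Ring2.Atlas.CyclotomicFiveK3PartnerAlgebraicInstance`, p193375;
refereeing pending) would pay ONE `(E, δ)`-row of reading (R)'s conclusion without R3; deform D.49 (INFERENCE,
referee pending) says that payment lifts to the R3-instance on `Y_λ × B₀²`.

Honest column: the generation hypotheses are Hodge-theoretic census statements about the member (NOT consequences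
of HC; for the K3 partners CERTIFIED by computation only); the floor fact is Markman's fourfold theorem
(arXiv:2502.03415 Thm. 1.5.1 / Cor. 1.6.1, UNREFEREED beyond the discriminants in print); R3 and its slice are OPEN
(print: Schoen's cyclic Prym loci only); the transport leaves are OPEN typed statements; every PRICE is a
consequence of `HodgeConjecture` (§G5).
References: [cite: Andre1992HodgeCM, Théorème] [cite: CharlesSchnell2014Notes, Thm. 11.5.21]
[cite: MoonenZarhin1999LowDim, Thm. 0.2 (e),(f) and §5; arXiv:math/9901113] [cite: MoonenZarhin1998WeilClasses, §1]
[cite: Markman2025SecantWeil, Thm. 1.5.1, Cor. 1.6.1 (preprint, unrefereed)] [cite: vanGeemen1994HodgeAV, §3.7 and Thm. 6.12]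
[cite: VoisinHodgeI2002, Thms. 6.25, 11.30] [cite: VoisinHodgeII2003, Prop. 9.20] [cite: Deligne1982HodgeCycles, §4–5]
[cite: Milne1999, §7 (H)] [cite: Deligne2000, §1]
-/

set_option linter.dupNamespace false

noncomputable section

open CategoryTheory Literature.AlgebraicGeometry Literature.AlgebraicGeometry.Motives
open Literature.AlgebraicGeometry.HodgeTheory Literature.AlgebraicGeometry.Milne1999
open Literature.AlgebraicTopology.SingularHomology Literature.Barriers.HodgeConjecture

namespace Summit.HodgeConjecture.HodgeConjecture.Ring2.ClassTargets

open WeilTypeLadder Ring2Transport Ring2.Atlas Ring2.Motiv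

/-! ## §G0 Generation shapes on a member (definitions; hypotheses, never asserted) -/

/-- **Codimension-`2` generation by divisors and a SEED SET `S`**: every rational `(2,2)` class of `A` lies in
`D²(A) ⊔ span S`. A typed hypothesis shape on the member (e.g. `S = codimTwoWeilPullbacks A`: X2′'s third summand;
the census reads such shapes off the Mumford–Tate group). [cite: MoonenZarhin1999LowDim, Thm. 0.2 (e),(f) and §5] -/
def IsCodimTwoGeneratedBy (A : AbelianVariety ℂ) (S : Set (complexBetti A.X (2 * 2))) : Prop :=
  ∀ c : complexBetti A.X (2 * 2), IsRationalClass c → IsOfHodgeType A.dim A.X (2 * 2) 2 2 c →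
    c ∈ divisorClassesSpan A.X A.dim 2 ⊔ Submodule.span ℂ S

/-- **Codimension-`3` generation by divisors and `B²·B¹`**: every rational `(3,3)` class of `A` lies in
`D³(A) ⊔ span{a ⌣ b : a rational (2,2), b rational (1,1)}` — X1's first two summands, on the member (the atlas reads
`B³ = D³ + K·D¹` for the K3 partners). [cite: MoonenZarhin1999LowDim, §2 and §5] -/
def IsCodimThreeProductGenerated (A : AbelianVariety ℂ) : Prop :=
  ∀ c : complexBetti A.X (2 * 3), IsRationalClass c → IsOfHodgeType A.dim A.X (2 * 3) 3 3 c →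
    c ∈ divisorClassesSpan A.X A.dim 3 ⊔ Submodule.span ℂ {w' : complexBetti A.X (2 * 3) |
      ∃ (a : complexBetti A.X (2 * 2)) (b : complexBetti A.X (2 * 1)),
        IsRationalClass a ∧ IsOfHodgeType A.dim A.X (2 * 2) 2 2 a ∧ IsRationalClass b ∧
        IsOfHodgeType A.dim A.X (2 * 1) 1 1 b ∧ w' = cupProduct (two_mul_add_two_mul 2 1) a b}

/-- **`IsWeilPullbackGenerated A` — the K3-PARTNER SHAPE**: codimension `2` generated by `D²` and André's
codimension-2 Weil pull-backs `codimTwoWeilPullbacks A` (X2′'s third summand), codimension `3` by `D³` and `B²·B¹`.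
For the K3-partner sixfolds `Y × Z` this is the cell's computation K3-WP + the atlas census (module docstring) —
a HYPOTHESIS here. [cite: Andre1992HodgeCM, Théorème] [cite: MoonenZarhin1999LowDim, §5] -/
def IsWeilPullbackGenerated (A : AbelianVariety ℂ) : Prop :=
  IsCodimTwoGeneratedBy A (codimTwoWeilPullbacks A) ∧ IsCodimThreeProductGenerated A

/-- Monotonicity in the seed set. [folklore] -/
theorem IsCodimTwoGeneratedBy.mono {A : AbelianVariety ℂ} {S T : Set (complexBetti A.X (2 * 2))}
    (h : IsCodimTwoGeneratedBy A S) (hST : S ⊆ T) : IsCodimTwoGeneratedBy A T := by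
  intro c hc hct
  have hle : divisorClassesSpan A.X A.dim 2 ⊔ Submodule.span ℂ S ≤
      divisorClassesSpan A.X A.dim 2 ⊔ Submodule.span ℂ T := sup_le_sup_left (Submodule.span_mono hST) _
  exact hle (h c hc hct)

/-- A member generated in codimension `2` by `D²` and Weil pull-backs satisfies X2′'s clause (the lower-dimensional
summand is simply not needed). [cite: MoonenZarhin1999LowDim, Thm. 0.2 (e),(f)] -/
theorem codimTwoFromWeilPullbacks_clause_of_isCodimTwoGeneratedBy {A : AbelianVariety ℂ}
    (h : IsCodimTwoGeneratedBy A (codimTwoWeilPullbacks A)) :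
    ∀ c : complexBetti A.X (2 * 2), IsRationalClass c → IsOfHodgeType A.dim A.X (2 * 2) 2 2 c →
      c ∈ divisorClassesSpan A.X A.dim 2 ⊔ Submodule.span ℂ (codimTwoLowerDimPullbacks A) ⊔
        Submodule.span ℂ (codimTwoWeilPullbacks A) := by
  intro c hc hct
  have hle : divisorClassesSpan A.X A.dim 2 ⊔ Submodule.span ℂ (codimTwoWeilPullbacks A) ≤
      divisorClassesSpan A.X A.dim 2 ⊔ Submodule.span ℂ (codimTwoLowerDimPullbacks A) ⊔
        Submodule.span ℂ (codimTwoWeilPullbacks A) := sup_le (le_sup_left.trans le_sup_left) le_sup_right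
  exact hle (h c hc hct)

/-! ## §G1 The engine: HC of a member of dimension `≤ 7` from the two shapes and algebraic seeds -/

/-- **ENGINE.** For a complex abelian variety `A` of dimension `≤ 7`: if its codimension-`2` classes are generated by
`D²` and an ALGEBRAIC seed set `S`, and its codimension-`3` classes by `D³` and `B²·B¹`, then `HC(A)`. Proof:
`p = 0` trivial; `p = 1` Lefschetz `(1,1)` (tree theorem); `p = 2` divisor monomials
(`AbelianVariety.divisorClassesSpan_le_algebraicClasses`) and `span S ≤ N²`; `p = 3` divisor monomials and
`N² ⌣ N¹ ⊆ N³` on an abelian variety (`AbelianVariety.cupProduct_mem_algebraicClasses_one`, Kleiman moving); for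
`2p > dim A` hard Lefschetz from codimension `dim A − p ≤ 3` (`mem_algebraicClasses_of_lt_of_nonempty`). No floor,
no `W₆`, no `HC_CM`. [cite: VoisinHodgeI2002, Thms. 6.25, 11.30] [cite: VoisinHodgeII2003, Prop. 9.20] -/
theorem hodgeConjectureFor_of_generated_of_seeds_algebraic {A : AbelianVariety ℂ} (hA : A.dim ≤ 7)
    {S : Set (complexBetti A.X (2 * 2))} (hS : S ⊆ ↑(algebraicClasses A.X 2))
    (h₂ : IsCodimTwoGeneratedBy A S) (h₃ : IsCodimThreeProductGenerated A) :
    HodgeConjectureFor A.dim A.X := by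
  have hX : IsSmoothProjective A.dim A.X := AbelianVariety.isSmoothProjective_holds
  have h11 : ∀ b : complexBetti A.X (2 * 1), IsRationalClass b →
      IsOfHodgeType A.dim A.X (2 * 1) 1 1 b → b ∈ algebraicClasses A.X 1 :=
    fun b hb hbt ↦ lefschetzOneOne_rational_holds hX b hb hbt
  have hp2 : ∀ c : complexBetti A.X (2 * 2), IsRationalClass c →
      IsOfHodgeType A.dim A.X (2 * 2) 2 2 c → c ∈ algebraicClasses A.X 2 := fun c hc hct ↦
    (sup_le (AbelianVariety.divisorClassesSpan_le_algebraicClasses A h11 2) (Submodule.span_le.mpr hS))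
      (h₂ c hc hct)
  have hp3 : ∀ c : complexBetti A.X (2 * 3), IsRationalClass c →
      IsOfHodgeType A.dim A.X (2 * 3) 3 3 c → c ∈ algebraicClasses A.X 3 := by
    intro c hc hct
    refine (sup_le (AbelianVariety.divisorClassesSpan_le_algebraicClasses A h11 3)
      (Submodule.span_le.mpr ?_)) (h₃ c hc hct)
    rintro _ ⟨a, b, ha, hat, hb, hbt, rfl⟩
    exact AbelianVariety.cupProduct_mem_algebraicClasses_one A (hp2 a ha hat) (h11 b hb hbt)
  have hlow : ∀ p : ℕ, 2 * p ≤ A.dim → ∀ c : complexBetti A.X (2 * p), IsRationalClass c →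
      IsOfHodgeType A.dim A.X (2 * p) p p c → c ∈ algebraicClasses A.X p := by
    intro p hp c hc hct
    have hp3' : p ≤ 3 := by omega
    interval_cases p
    · exact hodgeConjectureFor_codim_zero c
    · exact h11 c hc hct
    · exact hp2 c hc hct
    · exact hp3 c hc hct
  refine ⟨nonempty_hodgeModel_holds hX, fun p c hc hct ↦ ?_⟩
  by_cases hp : 2 * p ≤ A.dim
  · exact hlow p hp c hc hct
  · exact mem_algebraicClasses_of_lt_of_nonempty (nonempty_hardLefschetzNFold_holds A.dim A.X) hX
      (by omega) (hlow (A.dim - p) (by omega)) c hc hct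

/-- The engine on a CLASS: every member of `𝒦` of dimension `≤ 7`, generated as above by algebraic seeds, gives
`HCOnClass 𝒦`. [cite: VoisinHodgeI2002, Thms. 6.25, 11.30] -/
theorem hcOnClass_of_generated_of_seeds_algebraic {𝒦 : AbelianVariety ℂ → Prop}
    (h𝒦 : ∀ A : AbelianVariety ℂ, 𝒦 A → A.dim ≤ 7 ∧ ∃ S : Set (complexBetti A.X (2 * 2)),
      S ⊆ ↑(algebraicClasses A.X 2) ∧ IsCodimTwoGeneratedBy A S ∧ IsCodimThreeProductGenerated A) :
    HCOnClass 𝒦 := by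
  intro A hA
  obtain ⟨hA7, S, hS, h₂, h₃⟩ := h𝒦 A hA
  exact hodgeConjectureFor_of_generated_of_seeds_algebraic hA7 hS h₂ h₃

/-! ## §G2 The seeds `codimTwoWeilPullbacks A` are algebraic — three prices -/

/-- **(C) From HC on a class `𝒞`, the floor fact and the codimension-2 CM-field price off `𝒞`** (pointwise form of
§W2's pricing): a fourfold source is paid by the floor fact (Weil classes of Weil-type fourfolds algebraic), a
CM-field source `B ∈ 𝒞` by `h𝒞`, `B ∉ 𝒞` by the price; pull-backs of algebraic classes along morphisms of abelian
varieties are algebraic. [cite: Andre1992HodgeCM, Théorème] [cite: Markman2025SecantWeil, Cor. 1.6.1 (preprint, unrefereed)]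
[cite: MoonenZarhin1998WeilClasses, §1] -/
theorem codimTwoWeilPullbacks_subset_algebraicClasses_of_floor_of_hcOnClass_of_priceOff
    {𝒞 : AbelianVariety ℂ → Prop} (hW : Markman2025_weilClasses_algebraic_abelianFourfold) (h𝒞 : HCOnClass 𝒞)
    (h₆ : CodimTwoWeilClassesCMFieldOff 𝒞) (A : AbelianVariety ℂ) :
    codimTwoWeilPullbacks A ⊆ ↑(algebraicClasses A.X 2) := by
  have hX : IsSmoothProjective A.dim A.X := AbelianVariety.isSmoothProjective_holds
  rintro _ (⟨B, g, d, ψ, w, hB, hd, hψ, hw, hwt, hweil, rfl⟩ |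
    ⟨B, g, ψ, P, e, w, hP, hPe, he, hirr, hev, hdim, hreal, hQ, hweil, hw, hwt, rfl⟩)
  · have hXB : IsSmoothProjective (2 * 2) B.X := by
      rw [← hB]; exact AbelianVariety.isSmoothProjective_holds
    exact map_mem_algebraicClasses_of_abelianVariety hX B g (hW d hd B ψ hB hXB hψ w hw hwt hweil)
  · refine map_mem_algebraicClasses_of_abelianVariety hX B g ?_
    by_cases hB𝒞 : 𝒞 B
    · exact (h𝒞 B hB𝒞).2 2 w hw hwt
    · exact h₆ B ψ P e hP hPe he hirr hev hdim hreal hQ hB𝒞 w hweil hw hwt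

/-- **(R) From the floor fact ∧ rung R3** (`𝒞 = ∅`; R3 read through its codimension-2 slice
`codimTwoWeilClassesCMFieldOff_of_weilClassesCMField`). `HC_CM` ABSENT. [cite: MoonenZarhin1998WeilClasses, §1]
[cite: Markman2025SecantWeil, Cor. 1.6.1 (preprint, unrefereed)] -/
theorem codimTwoWeilPullbacks_subset_algebraicClasses_of_floor_of_weilClassesCMField
    (hW : Markman2025_weilClasses_algebraic_abelianFourfold) (hR3 : WeilClassesCMField) (A : AbelianVariety ℂ) :
    codimTwoWeilPullbacks A ⊆ ↑(algebraicClasses A.X 2) :=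
  codimTwoWeilPullbacks_subset_algebraicClasses_of_floor_of_hcOnClass_of_priceOff (𝒞 := fun _ ↦ False) hW
    (fun _ h ↦ h.elim) (codimTwoWeilClassesCMFieldOff_of_weilClassesCMField hR3 _) A

/-- **(T) From `HC_CM` and the four transport leaves of `Ring2TransportWeilClasses`** (CM-pointed Weil families +
Weil-confined variational Hodge, quadratic and CM-field): R∞ gives the floor fact at `n = 2`
(`floorFourfolds_of_weilClassesImaginaryQuadratic`), R3 the CM-field sources; `HC_CM` is the CM ANCHOR of both
transports (load-bearing twice). [cite: Deligne1982HodgeCycles, §4–5] [cite: Milne1999, §7 (H)] -/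
theorem codimTwoWeilPullbacks_subset_algebraicClasses_of_hcCM_of_transport
    (hCM : Theses.RankFourFaces.CMAbelianHodge) (hPq : CMPointedWeilFamiliesQuadratic)
    (hVq : WeilVariationalHodgeQuadratic) (hP : CMPointedWeilFamiliesCMField) (hV : WeilVariationalHodgeCMField)
    (A : AbelianVariety ℂ) : codimTwoWeilPullbacks A ⊆ ↑(algebraicClasses A.X 2) :=
  codimTwoWeilPullbacks_subset_algebraicClasses_of_floor_of_weilClassesCMField
    (floorFourfolds_of_weilClassesImaginaryQuadratic (HC_WeilClassesQuadratic_of_HC_CM hCM hPq hVq))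
    (HC_WeilClassesCMField_of_HC_CM hCM hP hV) A

/-! ## §G3 Per-member and per-class theorems, three readings -/

/-- **(R) `HC(A)` for a Weil-pull-back-generated `A` of dimension `≤ 7` from the floor fact ∧ R3 — `HC_CM` ABSENT.**
The K3-partner row's kernel statement: "under R3 (its codimension-2 slice at the eightfold sources), above the
floor". [cite: MoonenZarhin1998WeilClasses, §1] [cite: Markman2025SecantWeil, Cor. 1.6.1 (preprint, unrefereed)]
[cite: VoisinHodgeI2002, Thms. 6.25, 11.30] -/
theorem hodgeConjectureFor_of_isWeilPullbackGenerated_of_floor_of_weilClassesCMField {A : AbelianVariety ℂ}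
    (hA : A.dim ≤ 7) (hgen : IsWeilPullbackGenerated A) (hW : Markman2025_weilClasses_algebraic_abelianFourfold)
    (hR3 : WeilClassesCMField) : HodgeConjectureFor A.dim A.X :=
  hodgeConjectureFor_of_generated_of_seeds_algebraic hA
    (codimTwoWeilPullbacks_subset_algebraicClasses_of_floor_of_weilClassesCMField hW hR3 A) hgen.1 hgen.2

/-- **(C) `HC(A)` from HC on a class `𝒞`, the floor fact and the price off `𝒞`.** [cite: MoonenZarhin1998WeilClasses, §1]
[cite: Andre1992HodgeCM, Théorème] -/
theorem hodgeConjectureFor_of_isWeilPullbackGenerated_of_floor_of_hcOnClass_of_priceOff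
    {𝒞 : AbelianVariety ℂ → Prop} {A : AbelianVariety ℂ} (hA : A.dim ≤ 7) (hgen : IsWeilPullbackGenerated A)
    (hW : Markman2025_weilClasses_algebraic_abelianFourfold) (h𝒞 : HCOnClass 𝒞)
    (h₆ : CodimTwoWeilClassesCMFieldOff 𝒞) : HodgeConjectureFor A.dim A.X :=
  hodgeConjectureFor_of_generated_of_seeds_algebraic hA
    (codimTwoWeilPullbacks_subset_algebraicClasses_of_floor_of_hcOnClass_of_priceOff hW h𝒞 h₆ A) hgen.1 hgen.2

/-- **(C, `𝒞 = CM`) `HC(A)` from `HC_CM` (binder, by name), the floor fact and the price off the CM locus.**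
[cite: Milne1999, §7 (H)] [cite: MoonenZarhin1998WeilClasses, §1] -/
theorem hodgeConjectureFor_of_isWeilPullbackGenerated_of_hcCM_of_floor_of_priceOffCM
    (hCM : Theses.RankFourFaces.CMAbelianHodge) (hW : Markman2025_weilClasses_algebraic_abelianFourfold)
    (h₆ : CodimTwoWeilClassesCMFieldOff IsOfCMType) {A : AbelianVariety ℂ} (hA : A.dim ≤ 7)
    (hgen : IsWeilPullbackGenerated A) : HodgeConjectureFor A.dim A.X :=
  hodgeConjectureFor_of_isWeilPullbackGenerated_of_floor_of_hcOnClass_of_priceOff hA hgen hW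
    (hcOnClass_cmType_of_hcCM hCM) h₆

/-- **(T) `HC(A)` from `HC_CM` and the four transport leaves** (`HC_CM` load-bearing as the anchor of both
transports). [cite: Deligne1982HodgeCycles, §4–5] [cite: Milne1999, §7 (H)] -/
theorem hodgeConjectureFor_of_isWeilPullbackGenerated_of_hcCM_of_transport
    (hCM : Theses.RankFourFaces.CMAbelianHodge) (hPq : CMPointedWeilFamiliesQuadratic)
    (hVq : WeilVariationalHodgeQuadratic) (hP : CMPointedWeilFamiliesCMField) (hV : WeilVariationalHodgeCMField)
    {A : AbelianVariety ℂ} (hA : A.dim ≤ 7) (hgen : IsWeilPullbackGenerated A) : HodgeConjectureFor A.dim A.X :=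
  hodgeConjectureFor_of_generated_of_seeds_algebraic hA
    (codimTwoWeilPullbacks_subset_algebraicClasses_of_hcCM_of_transport hCM hPq hVq hP hV A) hgen.1 hgen.2

/-- **(T′) `HC(A)` from `HC_CM`, the floor fact and the two CM-FIELD transport leaves only** (`HC_CM` load-bearing
ONCE, as the CM anchor of the `K`-Weil transport; the quadratic leaves replaced by the floor fact).
[cite: Deligne1982HodgeCycles, §4–5] [cite: Markman2025SecantWeil, Cor. 1.6.1 (preprint, unrefereed)] -/
theorem hodgeConjectureFor_of_isWeilPullbackGenerated_of_hcCM_of_floor_of_transportCMField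
    (hCM : Theses.RankFourFaces.CMAbelianHodge) (hW : Markman2025_weilClasses_algebraic_abelianFourfold)
    (hP : CMPointedWeilFamiliesCMField) (hV : WeilVariationalHodgeCMField) {A : AbelianVariety ℂ} (hA : A.dim ≤ 7)
    (hgen : IsWeilPullbackGenerated A) : HodgeConjectureFor A.dim A.X :=
  hodgeConjectureFor_of_isWeilPullbackGenerated_of_floor_of_weilClassesCMField hA hgen hW
    (HC_WeilClassesCMField_of_HC_CM hCM hP hV)

/-- **(R) on a CLASS**: a class of Weil-pull-back-generated members of dimension `≤ 7` satisfies HC given the floor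
fact ∧ R3 — `HC_CM` ABSENT. [cite: MoonenZarhin1998WeilClasses, §1] [cite: VoisinHodgeI2002, Thms. 6.25, 11.30] -/
theorem hcOnClass_of_isWeilPullbackGenerated_of_floor_of_weilClassesCMField {𝒦 : AbelianVariety ℂ → Prop}
    (h𝒦 : ∀ A : AbelianVariety ℂ, 𝒦 A → A.dim ≤ 7 ∧ IsWeilPullbackGenerated A)
    (hW : Markman2025_weilClasses_algebraic_abelianFourfold) (hR3 : WeilClassesCMField) : HCOnClass 𝒦 :=
  fun A hA ↦ hodgeConjectureFor_of_isWeilPullbackGenerated_of_floor_of_weilClassesCMField (h𝒦 A hA).1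
    (h𝒦 A hA).2 hW hR3

/-- **(C) on a CLASS**: HC on `𝒞`, the floor fact and the price off `𝒞` give HC on every class of
Weil-pull-back-generated members of dimension `≤ 7`. [cite: Andre1992HodgeCM, Théorème] [cite: MoonenZarhin1998WeilClasses, §1] -/
theorem hcOnClass_of_isWeilPullbackGenerated_of_floor_of_hcOnClass_of_priceOff {𝒦 𝒞 : AbelianVariety ℂ → Prop}
    (h𝒦 : ∀ A : AbelianVariety ℂ, 𝒦 A → A.dim ≤ 7 ∧ IsWeilPullbackGenerated A)
    (hW : Markman2025_weilClasses_algebraic_abelianFourfold) (h𝒞 : HCOnClass 𝒞)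
    (h₆ : CodimTwoWeilClassesCMFieldOff 𝒞) : HCOnClass 𝒦 :=
  fun A hA ↦ hodgeConjectureFor_of_isWeilPullbackGenerated_of_floor_of_hcOnClass_of_priceOff (h𝒦 A hA).1
    (h𝒦 A hA).2 hW h𝒞 h₆

/-! ## §G4 The K3-PARTNER CELL of atlas-2, by name, in three readings -/

/-- **(R) THE K3-PARTNER ROW PRICED: `HC(Y × Z)` for every `Y` simple of type IV with quartic field and every CM
surface `Z` (atlas-2's cell `HodgeQuarticTypeIVFourfoldTimesCMSurface`, isogeny-closed — van Geemen's Lemma 3.7 via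
`Ring2.Motiv.hodgeConjectureFor_of_prodCMCell_of_forall_prod`; `dim (Y × Z) = 4 + 2`) from the floor fact ∧ R3,
GIVEN the K3-partner shape of the strict products as a hypothesis (K3-WP + census; module docstring).** `HC_CM`
ABSENT; the floor fact serves only X2′'s fourfold summand. [cite: MoonenZarhin1999LowDim, §5]
[cite: vanGeemen1994HodgeAV, §3.7 Lemma 3.7] [cite: MoonenZarhin1998WeilClasses, §1] -/
theorem hodgeQuarticTypeIVFourfoldTimesCMSurface_of_isWeilPullbackGenerated_of_floor_of_weilClassesCMField
    (hgen : ∀ Y Z : AbelianVariety ℂ, IsQuarticFieldTypeIVFourfold Y → IsOfCMType Z → Z.dim = 2 →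
      IsWeilPullbackGenerated (Y.prod Z))
    (hW : Markman2025_weilClasses_algebraic_abelianFourfold) (hR3 : WeilClassesCMField) :
    HodgeQuarticTypeIVFourfoldTimesCMSurface :=
  fun _ hX ↦ hodgeConjectureFor_of_prodCMCell_of_forall_prod
    (fun Y Z hY hZt hZ ↦ hodgeConjectureFor_of_isWeilPullbackGenerated_of_floor_of_weilClassesCMField
      (show (Y.prod Z).dim ≤ 7 by rw [AbelianVariety.dim_prod, hY.1, hZ]; norm_num) (hgen Y Z hY hZt hZ) hW hR3)
    hX

/-- **(C, `𝒞 = CM`) the cell from `HC_CM`, the floor fact and the codimension-2 CM-field price off the CM locus**,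
given the shape. [cite: Milne1999, §7 (H)] [cite: MoonenZarhin1998WeilClasses, §1] -/
theorem hodgeQuarticTypeIVFourfoldTimesCMSurface_of_isWeilPullbackGenerated_of_hcCM_of_floor_of_priceOffCM
    (hCM : Theses.RankFourFaces.CMAbelianHodge) (hW : Markman2025_weilClasses_algebraic_abelianFourfold)
    (h₆ : CodimTwoWeilClassesCMFieldOff IsOfCMType)
    (hgen : ∀ Y Z : AbelianVariety ℂ, IsQuarticFieldTypeIVFourfold Y → IsOfCMType Z → Z.dim = 2 →
      IsWeilPullbackGenerated (Y.prod Z)) :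
    HodgeQuarticTypeIVFourfoldTimesCMSurface :=
  fun _ hX ↦ hodgeConjectureFor_of_prodCMCell_of_forall_prod
    (fun Y Z hY hZt hZ ↦ hodgeConjectureFor_of_isWeilPullbackGenerated_of_hcCM_of_floor_of_priceOffCM hCM hW h₆
      (show (Y.prod Z).dim ≤ 7 by rw [AbelianVariety.dim_prod, hY.1, hZ]; norm_num) (hgen Y Z hY hZt hZ))
    hX

/-- **(T′) the cell from `HC_CM`, the floor fact and the two CM-FIELD transport leaves** (`HC_CM` load-bearing ONCE:
the CM anchor of the transport along the `(E, 4, δ)` Weil components through the eightfold sources), given the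
shape. [cite: Deligne1982HodgeCycles, §4–5] [cite: Milne1999, §7 (H)] -/
theorem hodgeQuarticTypeIVFourfoldTimesCMSurface_of_isWeilPullbackGenerated_of_hcCM_of_floor_of_transportCMField
    (hCM : Theses.RankFourFaces.CMAbelianHodge) (hW : Markman2025_weilClasses_algebraic_abelianFourfold)
    (hP : CMPointedWeilFamiliesCMField) (hV : WeilVariationalHodgeCMField)
    (hgen : ∀ Y Z : AbelianVariety ℂ, IsQuarticFieldTypeIVFourfold Y → IsOfCMType Z → Z.dim = 2 →
      IsWeilPullbackGenerated (Y.prod Z)) :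
    HodgeQuarticTypeIVFourfoldTimesCMSurface :=
  hodgeQuarticTypeIVFourfoldTimesCMSurface_of_isWeilPullbackGenerated_of_floor_of_weilClassesCMField hgen hW
    (HC_WeilClassesCMField_of_HC_CM hCM hP hV)

/-- **(T) the cell from `HC_CM` and the four transport leaves**, given the shape. [cite: Deligne1982HodgeCycles, §4–5] -/
theorem hodgeQuarticTypeIVFourfoldTimesCMSurface_of_isWeilPullbackGenerated_of_hcCM_of_transport
    (hCM : Theses.RankFourFaces.CMAbelianHodge) (hPq : CMPointedWeilFamiliesQuadratic)
    (hVq : WeilVariationalHodgeQuadratic) (hP : CMPointedWeilFamiliesCMField) (hV : WeilVariationalHodgeCMField)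
    (hgen : ∀ Y Z : AbelianVariety ℂ, IsQuarticFieldTypeIVFourfold Y → IsOfCMType Z → Z.dim = 2 →
      IsWeilPullbackGenerated (Y.prod Z)) :
    HodgeQuarticTypeIVFourfoldTimesCMSurface :=
  hodgeQuarticTypeIVFourfoldTimesCMSurface_of_isWeilPullbackGenerated_of_hcCM_of_floor_of_transportCMField hCM
    (floorFourfolds_of_weilClassesImaginaryQuadratic (HC_WeilClassesQuadratic_of_HC_CM hCM hPq hVq)) hP hV hgen

/-! ## §G5 Audit: the prices are on-path; the shapes are not consequences of HC and are never asserted -/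

/-- ON-PATH: the seed classes being algebraic is a consequence of the summit (through the ladder's on-path lemmas for
R∞ and R3); the cell itself is on-path by atlas-2's `hodgeQuarticTypeIVFourfoldTimesCMSurface_of_hodgeConjecture`.
The shapes `IsCodimTwoGeneratedBy` / `IsCodimThreeProductGenerated` are Hodge-theoretic and stay hypotheses.
[cite: Deligne2000, §1] -/
theorem weilPullbackGenerated_prices_of_hodgeConjecture (h : _root_.HodgeConjecture) (A : AbelianVariety ℂ) :
    codimTwoWeilPullbacks A ⊆ ↑(algebraicClasses A.X 2) ∧ HodgeQuarticTypeIVFourfoldTimesCMSurface :=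
  ⟨codimTwoWeilPullbacks_subset_algebraicClasses_of_floor_of_weilClassesCMField
      (floorFourfolds_of_weilClassesImaginaryQuadratic (weilClassesImaginaryQuadratic_of_hodgeConjecture h))
      (weilClassesCMField_of_hodgeConjecture h) A,
    hodgeQuarticTypeIVFourfoldTimesCMSurface_of_hodgeConjecture h⟩

/-- TRIVIAL SHAPE: a member whose `(2,2)` classes are all algebraic is generated by the seed set of its algebraic
classes — so the engine's codimension-`2` hypothesis is implied by HC on the member (its codimension-`3` hypothesis is
not: it is a census statement). [cite: Deligne2000, §1] -/
theorem isCodimTwoGeneratedBy_algebraicClasses_of_hodgeConjectureFor {A : AbelianVariety ℂ}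
    (h : HodgeConjectureFor A.dim A.X) : IsCodimTwoGeneratedBy A ↑(algebraicClasses A.X 2) :=
  fun c hc hct ↦ Submodule.mem_sup_right (Submodule.subset_span ((h.2 2 c hc hct)))

/-! ## §G6 (rev. 2) The transport reading WITHOUT `HC_CM`: divisor-generated CM anchors (transport (xii-a)) -/

/-- **(T″) seeds algebraic from the four transport leaves in their DIVISOR-GENERATED-ANCHOR form — `HC_CM` ABSENT.**
Transport's anchored rows `HC_WeilClassesQuadratic_of_divisorGeneratedCMPointed` /
`HC_WeilClassesCMField_of_divisorGeneratedCMPointed` (p185227; the CM anchor `B_Φ^{2m}` is divisor-generated, hence paid by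
Lefschetz `(1,1)`, not by `HC_CM`) replace `HC_CM` + `CMPointed…` in (T). Transport §(xii-a) (gen 8): at (`E` quartic, `m = 2`) every
`δ`-component carries the diagonal CM member and every quartic CM field is anchor-good — the typed ∀-statement below is still a
HYPOTHESIS (all fields, all `m`). [cite: Deligne1982HodgeCycles, §4–5] [cite: Andre1992HodgeCM, Théorème] -/
theorem codimTwoWeilPullbacks_subset_algebraicClasses_of_divisorGeneratedCMPointed
    (hPq : DivisorGeneratedCMPointedWeilFamiliesQuadratic) (hVq : WeilVariationalHodgeQuadratic)
    (hP : DivisorGeneratedCMPointedWeilFamiliesCMField) (hV : WeilVariationalHodgeCMField) (A : AbelianVariety ℂ) :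
    codimTwoWeilPullbacks A ⊆ ↑(algebraicClasses A.X 2) :=
  codimTwoWeilPullbacks_subset_algebraicClasses_of_floor_of_weilClassesCMField
    (floorFourfolds_of_weilClassesImaginaryQuadratic (HC_WeilClassesQuadratic_of_divisorGeneratedCMPointed hPq hVq))
    (HC_WeilClassesCMField_of_divisorGeneratedCMPointed hP hV) A

/-- **(T″) `HC(A)` for a Weil-pull-back-generated `A` of dimension `≤ 7` from the floor fact and the two CM-FIELD transport leaves
with divisor-generated anchors — `HC_CM` ABSENT.** [cite: Deligne1982HodgeCycles, §4–5]
[cite: Markman2025SecantWeil, Cor. 1.6.1 (preprint, unrefereed)] -/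
theorem hodgeConjectureFor_of_isWeilPullbackGenerated_of_floor_of_divisorGeneratedCMPointed
    (hW : Markman2025_weilClasses_algebraic_abelianFourfold) (hP : DivisorGeneratedCMPointedWeilFamiliesCMField)
    (hV : WeilVariationalHodgeCMField) {A : AbelianVariety ℂ} (hA : A.dim ≤ 7) (hgen : IsWeilPullbackGenerated A) :
    HodgeConjectureFor A.dim A.X :=
  hodgeConjectureFor_of_isWeilPullbackGenerated_of_floor_of_weilClassesCMField hA hgen hW
    (HC_WeilClassesCMField_of_divisorGeneratedCMPointed hP hV)

/-- **(T″) THE K3-PARTNER CELL from the floor fact and the two CM-FIELD transport leaves with divisor-generated anchors, given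
the shape — `HC_CM` ABSENT** (the fourth column of RING2-MAP §LEAD gen 8: open = the moduli leaf + Weil-confined VHC on the
`(E, 4, δ)` component through `Y × Z²`; concurs with deform D.49 (Q2)). [cite: Deligne1982HodgeCycles, §4–5] [cite: Milne1999, §7 (H)] -/
theorem hodgeQuarticTypeIVFourfoldTimesCMSurface_of_isWeilPullbackGenerated_of_floor_of_divisorGeneratedCMPointed
    (hW : Markman2025_weilClasses_algebraic_abelianFourfold) (hP : DivisorGeneratedCMPointedWeilFamiliesCMField)
    (hV : WeilVariationalHodgeCMField)
    (hgen : ∀ Y Z : AbelianVariety ℂ, IsQuarticFieldTypeIVFourfold Y → IsOfCMType Z → Z.dim = 2 →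
      IsWeilPullbackGenerated (Y.prod Z)) :
    HodgeQuarticTypeIVFourfoldTimesCMSurface :=
  hodgeQuarticTypeIVFourfoldTimesCMSurface_of_isWeilPullbackGenerated_of_floor_of_weilClassesCMField hgen hW
    (HC_WeilClassesCMField_of_divisorGeneratedCMPointed hP hV)

end Summit.HodgeConjecture.HodgeConjecture.Ring2.ClassTargets

end
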